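import Summits.QuantumFields.BalabanUV.T4Continuum.Support.NE7ConvOneStepGenericSlice
import Summits.QuantumFields.BalabanUV.T4Continuum.Support.NE7ConvOneStepWeightedUnique
import HarnessLib

/-!
# NE7ConvOneStepGenericSliceTangent — F19 (`NE7ConvOneStepTangent`) AND F26 (`NE7ConvOneStepWeightedUnique`) OVER AN ABSTRACT SLICE FAMILY `𝒯 k W`:
# CONV-ONE-STEP and ONE-STEP from tangent criticality + REP over `𝒯`, the STRICT form (at most one minimal orbit) and ALL-SMALL with the gauge identity, and their
# instances for the corner-free energy block-Landau slice `𝒯_E = energyBlockLandauW` at `d = 4`, `L = 2`, SU(2) — files 2–3 of the END re-thread (memo ROAD-G99 §3.5)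

Cell `pub-balaban`, rung (B)+1 sub-cell t4, lineage `b2b-balaban-t4-ne7-p1`, generation 99 (CRUX PROVER NE7 #1 = OWNER of BINDER row NE7), companion of gen 99's
`NE7ConvOneStepGenericSlice` (p754830; the (hT)∕(hP) template).  Memo `t4/b2b-balaban-t4-ne7-p1-g99/ROAD-G99.md` §3.5-SPEC.

WHY.  The END chain of gens 67–98 (F19 `NE7ConvOneStepTangent` → F26 `NE7ConvOneStepWeightedUnique` → F27∕F28 `NE7OneStepOfPathOpen`∕`NE7OneStepOfSectorApeRep` → … →
gen 95's END) hardcodes the slice `T_♮(W) = frameFreeBlockLandauW L N (k+1) W` (row NE3) in every `hP` and every `hrep`.  Gen 99's numerics (memo §1) killed the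
sup-level supplier for `T_♮` (corner dips), and the Bałaban-slice road (memo §3) replaces `T_♮` by the corner-free slice `𝒯_E(W) = energyBlockLandauW` — whose
criticality (`NE7MeanZeroGaugeSliceW.dAction_eq_zero_of_mem`) and class coercivity (`NE7EnergyBlockLandauClassPoincare.classSlicePoincare_energyBlockLandau_SU2`) are
in the tree.  The re-thread is done ONCE, generically: a slice family `𝒯 : ℕ → cfg → Set dir` with the two hypotheses
  (hT) `W ∈ sfClass … (j+1)` and tangent-criticality of `W` on a window `F` ⟹ `dAction W Y F = 0` for every `Y ∈ 𝒯 j W`;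
  (hP) `W ∈ sfClass … (j+1)` ⟹ `SlicePoincare L (j+1) W (𝒯 j W) CP (periodBox (N·L^{j+1}))`.
THIS FILE re-issues F19 §1–§2 and F26 §2–§3 over `(𝒯, hT, hP)` with the proofs of record otherwise verbatim, and instantiates at `𝒯_E`, `d = 4`, `L = 2`, SU(2)
(constant of record `8·CPLine 4 2 2 10⁻¹⁷ 10⁻⁵³ + 1`).
WHAT ([folklore]; 0 def, 0 sorry).
§1 **`isMinimiser_of_tanCritical_rep_generic`** (F19 §1 over `𝒯`), **`oneStep_of_tanCritical_rep_generic`** (F19 §2 over `𝒯`: the `hstep` binder of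
   `NE7InteriorInduction.interior_exists_all_levels` from CRIT-ONE-STEP on the tangent space + REP over `𝒯`).
§2 **`vary_eq_self_of_tanCritical_rep_generic`** (F26 §2 over `𝒯`: AT MOST ONE MINIMAL ORBIT under the STRICT line), **`smallField_of_le_of_rep_generic_gauge`**,
   **`allSmall_of_tanCritical_rep_generic_gauge`** (F26 §3 over `𝒯`: ALL-SMALL from REP over `𝒯` WITH THE GAUGE IDENTITY `U′^u = U♯e^X`),
   **`isMinimiser_of_tanCritical_rep_generic_gauge`** (CONV read off the gauge identity).
§3 instances at `𝒯_E`, `d = 4`, `L = 2`, SU(2), `0 < ε ≤ 10⁻⁵³`: **`oneStep_SU2_of_tanCritical_repE`** (F19 §3's `oneStep_SU2_of_tanCritical_repW` with `T_♮ ↦ 𝒯_E`,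
   `CPLine + 1 ↦ 8·CPLine + 1`), **`allSmall_SU2_of_tanCritical_repE_gauge`** (F26's ALL-SMALL on the SU(2) class over `𝒯_E`, no Poincaré hypothesis left).
HONEST FRAMING (page 1): convexity bookkeeping over HYPOTHESES (REP over `𝒯` with∕without the gauge identity, tangent criticality, (hT), (hP)); for `𝒯_E` at SU(2) the two
slice hypotheses are theorems of the tree, REP over `𝒯_E` (the supplier: ONE curved sup letter for `𝒯_E`, memo §3.4∕§3.7) is NOT proved; nothing is asserted about
Bałaban's minimisers; NOT ONE-STEP unconditionally, NOT NE7; spine 0∕9; finite T⁴ rung (B)+1 — NOT infinite volume, NOT mass gap, NOT BetaPertH, NOT Clay.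
Continuum YM on T⁴ ⇐ BetaPertH ∧ nine spine estimates (0/9 proved); BetaPertH ⇐ (D1) ∧ (D4) ∧ CAP+tail; G-an2-4 gates asym, D1 and NE2/3/4.
-/

set_option autoImplicit false

open scoped BigOperators Matrix.Norms.L2Operator
open NormedSpace Finset Set

namespace Summit.QuantumFields.BalabanUV.T4Continuum.NE7ConvOneStepGenericSliceTangent

open Literature.MathematicalPhysics.QuantumFieldTheory.Balaban1983to89
open B7Prop1Explicit B7Prop2Explicit MatrixLog UnitaryModel
open T4AveragingDeficitWall (IsUnitaryCfg IsSkewDir SmallField fineAction vary curl curlSq dirSq vary_zero_dir Plaq)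
open T4AveragingDeficitWallBoundary (IsPeriodicCfg periodBox)
open AveragingDeficitPeriodicCounting (IsPeriodicDir)
open AveragingDeficitMultiLevelPrep (tower LevelSmall TangentIter)
open AveragingDeficitMultiLevelBridge (tower_eq)
open MinimalActionLevels (levelAction perWin stepWt stepWt_pos)
open MinimalActionSandwich (IsMinimiser admissible)
open MinimalActionRate (sfClass)
open NE3HessForm (hess dAction)
open NE3HessShapes (plaqsOf)
open NE3SlicePoincareShape (SlicePoincare slicePoincare_mono)
open NE3EnergyWeightedShapes (energyNormW energyNormW_nonneg)
open NE3EnergyShapes (IsUnitarySite)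
open NE3SlicePoincareBudgetLine (CPLine)
open NE3ClassRadiusFamily (CPLine_nonneg_d4_L2)
open NE7SegmentPlaquetteRadius (smallField_vary_segment_class)
open NE7OneStepLetters (dAction_ge_of_tangent_critical)
open NE7ConvOneStepWeighted (curlSq_ge_weighted isMinimiser_of_critical_rep_weighted)
open NE7ConvOneStepWeightedUnique (energyNormW_sq_eq_zero_of_slop eq_zero_of_energyNormW_sq_eq_zero smallField_of_gaugeAct_eq)
open NE7EtaMinimiserGaugeCovariance (levelAction_gaugeAct)
open BlockAverageCurrent (smallField_gaugeAct)
open NE7ConvOneStepSU2 (levelSmall_all_d4_L2)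
open NE7MeanZeroGaugeSliceW (energyBlockLandauW)
open NE7EnergyBlockLandauClassPoincare (classSlicePoincare_energyBlockLandau_SU2)
open NE7ConvOneStepGenericSlice (hT_energyBlockLandau)

noncomputable section

variable {d : ℕ} {n : Type*} [Fintype n] [DecidableEq n]

/-! ## §1 CONV-ONE-STEP and ONE-STEP over an abstract slice family, tangent criticality, REP over `𝒯` -/

/-- **CONV-ONE-STEP OVER `𝒯` FROM CRITICALITY ON THE TANGENT SPACE AND REP WITH WEIGHTED NORMAL LETTERS** (F19 §1 with `T_♮ ↦ 𝒯 k U♯`; `L, N ≥ 1`, `ε ≥ 0`,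
`0 < CP`): (hT), (hP), `U♯ ∈ admissible (sfClass d L N ε) L (k+1) V` tangent-critical, every admissible `U′` represented over `U♯` by `X = X_T + X_N`, `X_T ∈ 𝒯 k U♯`,
with F9's weighted letters `ν`, `κ₁` under the numeric line ⟹ `U♯` is a minimiser (F9 `isMinimiser_of_critical_rep_weighted` at `T = 𝒯 k U♯`). [folklore] -/
theorem isMinimiser_of_tanCritical_rep_generic [Nonempty n] {L N k : ℕ} [NeZero L] [NeZero N] (hL : 1 ≤ L) (hN : 1 ≤ N) {ε CP : ℝ}
    (hε : 0 ≤ ε) (hCP : 0 < CP)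
    (𝒯 : ℕ → (Site d → Fin d → (Matrix n n ℂ)ˣ) → Set (Site d → Fin d → Matrix n n ℂ))
    (hT : ∀ (j : ℕ) (W : Site d → Fin d → (Matrix n n ℂ)ˣ), W ∈ sfClass d L N ε (j + 1) → ∀ F : Finset (Plaq d),
      (∀ φ : Site d → Fin d → Matrix n n ℂ, IsSkewDir φ → IsPeriodicDir φ ((tower L N (j + 1) : ℕ) : ℤ) → TangentIter L j W φ → dAction W φ F = 0) →
      ∀ Y ∈ 𝒯 j W, dAction W Y F = 0)
    (hP : ∀ (j : ℕ) (W : Site d → Fin d → (Matrix n n ℂ)ˣ), W ∈ sfClass d L N ε (j + 1) →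
      SlicePoincare L (j + 1) W (𝒯 j W) CP (periodBox (d := d) (N * L ^ (j + 1))))
    {V Us : Site d → Fin d → (Matrix n n ℂ)ˣ} (hmem : Us ∈ admissible (sfClass d L N ε) L (k + 1) V)
    (hcritT : ∀ φ : Site d → Fin d → Matrix n n ℂ, IsSkewDir φ → IsPeriodicDir φ ((N * L ^ (k + 1) : ℕ) : ℤ) → TangentIter L k Us φ →
      dAction Us φ (perWin d (N * L ^ (k + 1))) = 0)
    (hrep : ∀ U' ∈ admissible (sfClass d L N ε) L (k + 1) V, ∃ (X XT XN : Site d → Fin d → Matrix n n ℂ) (α ν κ₁ : ℝ),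
      IsSkewDir X ∧ IsPeriodicDir X ((N * L ^ (k + 1) : ℕ) : ℤ) ∧ 0 ≤ α ∧ (∀ x μ, ‖X x μ‖ ≤ α) ∧
      levelAction d L N (k + 1) (vary Us X 1) ≤ levelAction d L N (k + 1) U' ∧
      SmallField (vary Us X 1) (ε / ((L : ℝ) ^ (k + 1)) ^ 2) ∧
      X = XT + XN ∧ XT ∈ 𝒯 k Us ∧ IsSkewDir XN ∧ 0 ≤ ν ∧
      energyNormW L (k + 1) Us XN (periodBox (d := d) (N * L ^ (k + 1)))
        ≤ ν * energyNormW L (k + 1) Us X (periodBox (d := d) (N * L ^ (k + 1))) ∧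
      ε / ((L : ℝ) ^ (k + 1)) ^ 2 * (∑ p ∈ perWin d (N * L ^ (k + 1)), ‖curl Us XN p‖)
        ≤ κ₁ * energyNormW L (k + 1) Us X (periodBox (d := d) (N * L ^ (k + 1))) ^ 2 ∧
      2 * κ₁ ≤ ((((1 / 2 - ν ^ 2) / (2 * (1 + CP)) - ν ^ 2) / 2
          - 576 * d * (Real.exp α - 1) ^ 2 * ((L : ℝ) ^ (k + 1)) ^ 2) / (Fintype.card n : ℝ)
          - 28 * d * (ε / ((L : ℝ) ^ (k + 1)) ^ 2 + 7 * α ^ 2) * ((L : ℝ) ^ (k + 1)) ^ 2)) :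
    IsMinimiser d (sfClass d L N ε) L N (k + 1) V Us := by
  have ha : 0 ≤ ε / ((L : ℝ) ^ (k + 1)) ^ 2 := by positivity
  have htan : ∀ φ : Site d → Fin d → Matrix n n ℂ, IsSkewDir φ → IsPeriodicDir φ ((tower L N (k + 1) : ℕ) : ℤ) → TangentIter L k Us φ →
      dAction Us φ (perWin d (N * L ^ (k + 1))) = 0 := by
    intro φ hφs hφP hφT
    have hφP' : IsPeriodicDir φ ((N * L ^ (k + 1) : ℕ) : ℤ) := by rw [← tower_eq L N (k + 1)]; exact hφP
    exact hcritT φ hφs hφP' hφT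
  have hcrit : ∀ Y ∈ 𝒯 k Us, dAction Us Y (perWin d (N * L ^ (k + 1))) = 0 := hT k Us hmem.1 _ htan
  exact isMinimiser_of_critical_rep_weighted hL hN hmem hmem.1.1 ha hmem.1.2.2 hCP (hP k Us hmem.1) hcrit hrep

/-- **ONE-STEP OVER `𝒯` FROM «CRIT-ONE-STEP ON THE TANGENT SPACE + REP OVER `𝒯` WITH WEIGHTED NORMAL LETTERS» GIVEN (hT), (hP)** (F19 §2 with `T_♮ ↦ 𝒯`; the `hstep`
binder of `NE7InteriorInduction.interior_exists_all_levels`). [folklore] -/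
theorem oneStep_of_tanCritical_rep_generic [Nonempty n] {L N : ℕ} [NeZero L] [NeZero N] (hL : 1 ≤ L) (hN : 1 ≤ N) {ε δ CP : ℝ}
    (hε : 0 ≤ ε) (hCP : 0 < CP)
    (𝒯 : ℕ → (Site d → Fin d → (Matrix n n ℂ)ˣ) → Set (Site d → Fin d → Matrix n n ℂ))
    (hT : ∀ (j : ℕ) (W : Site d → Fin d → (Matrix n n ℂ)ˣ), W ∈ sfClass d L N ε (j + 1) → ∀ F : Finset (Plaq d),
      (∀ φ : Site d → Fin d → Matrix n n ℂ, IsSkewDir φ → IsPeriodicDir φ ((tower L N (j + 1) : ℕ) : ℤ) → TangentIter L j W φ → dAction W φ F = 0) →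
      ∀ Y ∈ 𝒯 j W, dAction W Y F = 0)
    (hP : ∀ (j : ℕ) (W : Site d → Fin d → (Matrix n n ℂ)ˣ), W ∈ sfClass d L N ε (j + 1) →
      SlicePoincare L (j + 1) W (𝒯 j W) CP (periodBox (d := d) (N * L ^ (j + 1))))
    {V : Site d → Fin d → (Matrix n n ℂ)ˣ}
    (hcrit : ∀ (k : ℕ) (U₀ : Site d → Fin d → (Matrix n n ℂ)ˣ), U₀ ∈ admissible (sfClass d L N ε) L (k + 1) V →
      SmallField U₀ (δ / ((L : ℝ) ^ k) ^ 2) →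
      ∃ Us : Site d → Fin d → (Matrix n n ℂ)ˣ, Us ∈ admissible (sfClass d L N ε) L (k + 1) V ∧ SmallField Us (δ / ((L : ℝ) ^ (k + 1)) ^ 2) ∧
        (∀ φ : Site d → Fin d → Matrix n n ℂ, IsSkewDir φ → IsPeriodicDir φ ((N * L ^ (k + 1) : ℕ) : ℤ) → TangentIter L k Us φ →
          dAction Us φ (perWin d (N * L ^ (k + 1))) = 0) ∧
        ∀ U' ∈ admissible (sfClass d L N ε) L (k + 1) V, ∃ (X XT XN : Site d → Fin d → Matrix n n ℂ) (α ν κ₁ : ℝ),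
          IsSkewDir X ∧ IsPeriodicDir X ((N * L ^ (k + 1) : ℕ) : ℤ) ∧ 0 ≤ α ∧ (∀ x μ, ‖X x μ‖ ≤ α) ∧
          levelAction d L N (k + 1) (vary Us X 1) ≤ levelAction d L N (k + 1) U' ∧
          SmallField (vary Us X 1) (ε / ((L : ℝ) ^ (k + 1)) ^ 2) ∧
          X = XT + XN ∧ XT ∈ 𝒯 k Us ∧ IsSkewDir XN ∧ 0 ≤ ν ∧
          energyNormW L (k + 1) Us XN (periodBox (d := d) (N * L ^ (k + 1)))
            ≤ ν * energyNormW L (k + 1) Us X (periodBox (d := d) (N * L ^ (k + 1))) ∧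
          ε / ((L : ℝ) ^ (k + 1)) ^ 2 * (∑ p ∈ perWin d (N * L ^ (k + 1)), ‖curl Us XN p‖)
            ≤ κ₁ * energyNormW L (k + 1) Us X (periodBox (d := d) (N * L ^ (k + 1))) ^ 2 ∧
          2 * κ₁ ≤ ((((1 / 2 - ν ^ 2) / (2 * (1 + CP)) - ν ^ 2) / 2
              - 576 * d * (Real.exp α - 1) ^ 2 * ((L : ℝ) ^ (k + 1)) ^ 2) / (Fintype.card n : ℝ)
              - 28 * d * (ε / ((L : ℝ) ^ (k + 1)) ^ 2 + 7 * α ^ 2) * ((L : ℝ) ^ (k + 1)) ^ 2)) :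
    ∀ (k : ℕ) (U₀ : Site d → Fin d → (Matrix n n ℂ)ˣ), U₀ ∈ admissible (sfClass d L N ε) L (k + 1) V →
      SmallField U₀ (δ / ((L : ℝ) ^ k) ^ 2) →
      ∃ U, IsMinimiser d (sfClass d L N ε) L N (k + 1) V U ∧ SmallField U (δ / ((L : ℝ) ^ (k + 1)) ^ 2) := by
  intro k U₀ hU₀ hU₀a
  obtain ⟨Us, hmem, hUsδ, hcr, hrep⟩ := hcrit k U₀ hU₀ hU₀a
  exact ⟨Us, isMinimiser_of_tanCritical_rep_generic hL hN hε hCP 𝒯 hT hP hmem hcr hrep, hUsδ⟩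

/-! ## §2 At most one minimal orbit modulo REP over `𝒯`, and ALL-SMALL with the gauge identity -/

/-- **AT MOST ONE MINIMAL ORBIT modulo REP OVER `𝒯`** (F26 §2 with `T_♮ ↦ 𝒯 k U♯`): (hT), (hP), `U♯ ∈ admissible (sfClass d L N ε) L (k+1) V` (`L, N ≥ 1`, `ε ≥ 0`)
tangent-critical; a competitor `U′` with `levelAction U′ ≤ levelAction U♯` REPRESENTED over `U♯` by a skew `(N·L^{k+1})`-periodic `X` (`‖X‖_∞ ≤ α`,
`levelAction (U♯e^X) ≤ levelAction U′`, `SmallField (U♯e^X) (ε(L^{k+1})^{−2})`, split `X = X_T + X_N`, `X_T ∈ 𝒯 k U♯`, F9's weighted letters `ν`, `κ₁`) under the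
STRICT line ⟹ `X = 0` and `U♯e^{X} = U♯`. [folklore] -/
theorem vary_eq_self_of_tanCritical_rep_generic [Nonempty n] {L N k : ℕ} [NeZero L] [NeZero N] (hL : 1 ≤ L) (hN : 1 ≤ N) {ε CP : ℝ}
    (hε : 0 ≤ ε) (hCP : 0 < CP)
    (𝒯 : ℕ → (Site d → Fin d → (Matrix n n ℂ)ˣ) → Set (Site d → Fin d → Matrix n n ℂ))
    (hT : ∀ (j : ℕ) (W : Site d → Fin d → (Matrix n n ℂ)ˣ), W ∈ sfClass d L N ε (j + 1) → ∀ F : Finset (Plaq d),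
      (∀ φ : Site d → Fin d → Matrix n n ℂ, IsSkewDir φ → IsPeriodicDir φ ((tower L N (j + 1) : ℕ) : ℤ) → TangentIter L j W φ → dAction W φ F = 0) →
      ∀ Y ∈ 𝒯 j W, dAction W Y F = 0)
    (hP : ∀ (j : ℕ) (W : Site d → Fin d → (Matrix n n ℂ)ˣ), W ∈ sfClass d L N ε (j + 1) →
      SlicePoincare L (j + 1) W (𝒯 j W) CP (periodBox (d := d) (N * L ^ (j + 1))))
    {V Us U' : Site d → Fin d → (Matrix n n ℂ)ˣ} (hmem : Us ∈ admissible (sfClass d L N ε) L (k + 1) V)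
    (hcritT : ∀ φ : Site d → Fin d → Matrix n n ℂ, IsSkewDir φ → IsPeriodicDir φ ((N * L ^ (k + 1) : ℕ) : ℤ) → TangentIter L k Us φ →
      dAction Us φ (perWin d (N * L ^ (k + 1))) = 0)
    (hmin' : levelAction d L N (k + 1) U' ≤ levelAction d L N (k + 1) Us)
    {X XT XN : Site d → Fin d → Matrix n n ℂ} {α ν κ₁ : ℝ} (hXs : IsSkewDir X) (hXP : IsPeriodicDir X ((N * L ^ (k + 1) : ℕ) : ℤ))
    (hα : 0 ≤ α) (hXα : ∀ x μ, ‖X x μ‖ ≤ α) (hle : levelAction d L N (k + 1) (vary Us X 1) ≤ levelAction d L N (k + 1) U')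
    (h1 : SmallField (vary Us X 1) (ε / ((L : ℝ) ^ (k + 1)) ^ 2)) (hsplit : X = XT + XN)
    (hXT : XT ∈ 𝒯 k Us) (hXNs : IsSkewDir XN)
    (hNw : energyNormW L (k + 1) Us XN (periodBox (d := d) (N * L ^ (k + 1)))
      ≤ ν * energyNormW L (k + 1) Us X (periodBox (d := d) (N * L ^ (k + 1))))
    (hN1 : ε / ((L : ℝ) ^ (k + 1)) ^ 2 * (∑ p ∈ perWin d (N * L ^ (k + 1)), ‖curl Us XN p‖)
      ≤ κ₁ * energyNormW L (k + 1) Us X (periodBox (d := d) (N * L ^ (k + 1))) ^ 2)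
    (hline : 2 * κ₁ < ((((1 / 2 - ν ^ 2) / (2 * (1 + CP)) - ν ^ 2) / 2
        - 576 * d * (Real.exp α - 1) ^ 2 * ((L : ℝ) ^ (k + 1)) ^ 2) / (Fintype.card n : ℝ)
        - 28 * d * (ε / ((L : ℝ) ^ (k + 1)) ^ 2 + 7 * α ^ 2) * ((L : ℝ) ^ (k + 1)) ^ 2)) :
    X = (fun _ _ => 0) ∧ vary Us X 1 = Us := by
  have hN0 : 0 < N := hN
  have hL0 : 0 < L := hL
  have hM : 1 ≤ N * L ^ (k + 1) := Nat.mul_pos hN0 (Nat.pow_pos hL0)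
  have e : perWin d (N * L ^ (k + 1)) = plaqsOf (periodBox (d := d) (N * L ^ (k + 1))) := rfl
  set a : ℝ := ε / ((L : ℝ) ^ (k + 1)) ^ 2 with hadef
  have ha : 0 ≤ a := by rw [hadef]; positivity
  have hUs : IsUnitaryCfg Us := hmem.1.1
  have hUsa : SmallField Us a := hmem.1.2.2
  set E := energyNormW L (k + 1) Us X (periodBox (d := d) (N * L ^ (k + 1))) ^ 2 with hEdef
  -- criticality on the slice part `X_T ∈ 𝒯 k U♯`, transferred from tangent criticality by (hT)
  have htan : ∀ φ : Site d → Fin d → Matrix n n ℂ, IsSkewDir φ → IsPeriodicDir φ ((tower L N (k + 1) : ℕ) : ℤ) → TangentIter L k Us φ →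
      dAction Us φ (perWin d (N * L ^ (k + 1))) = 0 := by
    intro φ hφs hφP hφT
    have hφP' : IsPeriodicDir φ ((N * L ^ (k + 1) : ℕ) : ℤ) := by rw [← tower_eq L N (k + 1)]; exact hφP
    exact hcritT φ hφs hφP' hφT
  have hcritXT : dAction Us XT (perWin d (N * L ^ (k + 1))) = 0 := hT k Us hmem.1 _ htan XT hXT
  -- the weighted size 1, squared, and the weighted Poincaré letter
  have hNw2 : energyNormW L (k + 1) Us XN (periodBox (d := d) (N * L ^ (k + 1))) ^ 2 ≤ ν ^ 2 * E := by
    have h0 := energyNormW_nonneg L (k + 1) Us XN (periodBox (d := d) (N * L ^ (k + 1)))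
    calc energyNormW L (k + 1) Us XN (periodBox (d := d) (N * L ^ (k + 1))) ^ 2
        ≤ (ν * energyNormW L (k + 1) Us X (periodBox (d := d) (N * L ^ (k + 1)))) ^ 2 := pow_le_pow_left₀ h0 hNw 2
      _ = ν ^ 2 * E := by rw [hEdef]; ring
  have hm := curlSq_ge_weighted hCP.le (hP k Us hmem.1) hsplit hXT hNw2
  -- the radius along the segment and the slop from tangent criticality
  have hrad : ∀ t ∈ Icc (0 : ℝ) 1, SmallField (vary Us X t) (a + 7 * α ^ 2) := fun t ht =>
    smallField_vary_segment_class hUs hXs hUsa h1 hXα ht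
  have ha' : 0 ≤ a + 7 * α ^ 2 := add_nonneg ha (mul_nonneg (by norm_num) (sq_nonneg α))
  have hslop : -(κ₁ * E) ≤ dAction Us X (plaqsOf (periodBox (d := d) (N * L ^ (k + 1)))) := by
    have h := dAction_ge_of_tangent_critical hUs hUsa hsplit hXNs (perWin d (N * L ^ (k + 1))) hcritXT
    rw [e] at h hN1
    linarith
  -- the action comparison on the fine window from the level actions
  have hw : 0 < ((stepWt d L)⁻¹) ^ (k + 1) := pow_pos (inv_pos.mpr (stepWt_pos (d := d) L hL)) _
  have hfine : fineAction (vary Us X 1) (plaqsOf (periodBox (d := d) (N * L ^ (k + 1))))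
      ≤ fineAction Us (plaqsOf (periodBox (d := d) (N * L ^ (k + 1)))) := by
    have h := hle.trans hmin'
    unfold levelAction at h
    rw [e] at h
    exact le_of_mul_le_mul_left h hw
  have hE0 := energyNormW_sq_eq_zero_of_slop (k := k + 1) hL hM hUs hXs hXP hα hXα hm ha' hrad hslop hline hfine
  have h0 := eq_zero_of_energyNormW_sq_eq_zero hL hM Us hXP hE0
  refine ⟨h0, ?_⟩
  rw [h0]
  exact vary_zero_dir Us 1

/-- **ALL-SMALL FOR ONE COMPETITOR OVER `𝒯`** (F26 §3 with `T_♮ ↦ 𝒯 k U♯`): under the hypotheses of `vary_eq_self_of_tanCritical_rep_generic` and the GAUGE IDENTITY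
`U′^u = U♯e^{X}` (`u` unitary), `SmallField U♯ r₁ ⟹ SmallField U′ r₁`. [folklore] -/
theorem smallField_of_le_of_rep_generic_gauge [Nonempty n] {L N k : ℕ} [NeZero L] [NeZero N] (hL : 1 ≤ L) (hN : 1 ≤ N) {ε CP : ℝ}
    (hε : 0 ≤ ε) (hCP : 0 < CP)
    (𝒯 : ℕ → (Site d → Fin d → (Matrix n n ℂ)ˣ) → Set (Site d → Fin d → Matrix n n ℂ))
    (hT : ∀ (j : ℕ) (W : Site d → Fin d → (Matrix n n ℂ)ˣ), W ∈ sfClass d L N ε (j + 1) → ∀ F : Finset (Plaq d),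
      (∀ φ : Site d → Fin d → Matrix n n ℂ, IsSkewDir φ → IsPeriodicDir φ ((tower L N (j + 1) : ℕ) : ℤ) → TangentIter L j W φ → dAction W φ F = 0) →
      ∀ Y ∈ 𝒯 j W, dAction W Y F = 0)
    (hP : ∀ (j : ℕ) (W : Site d → Fin d → (Matrix n n ℂ)ˣ), W ∈ sfClass d L N ε (j + 1) →
      SlicePoincare L (j + 1) W (𝒯 j W) CP (periodBox (d := d) (N * L ^ (j + 1))))
    {V Us U' : Site d → Fin d → (Matrix n n ℂ)ˣ} (hmem : Us ∈ admissible (sfClass d L N ε) L (k + 1) V)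
    (hcritT : ∀ φ : Site d → Fin d → Matrix n n ℂ, IsSkewDir φ → IsPeriodicDir φ ((N * L ^ (k + 1) : ℕ) : ℤ) → TangentIter L k Us φ →
      dAction Us φ (perWin d (N * L ^ (k + 1))) = 0)
    (hmin' : levelAction d L N (k + 1) U' ≤ levelAction d L N (k + 1) Us)
    {u : Site d → (Matrix n n ℂ)ˣ} (hu : IsUnitarySite u)
    {X XT XN : Site d → Fin d → Matrix n n ℂ} {α ν κ₁ : ℝ} (hXs : IsSkewDir X) (hXP : IsPeriodicDir X ((N * L ^ (k + 1) : ℕ) : ℤ))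
    (hα : 0 ≤ α) (hXα : ∀ x μ, ‖X x μ‖ ≤ α) (hgauge : gaugeAct u U' = vary Us X 1) (hsplit : X = XT + XN)
    (hXT : XT ∈ 𝒯 k Us) (hXNs : IsSkewDir XN)
    (hNw : energyNormW L (k + 1) Us XN (periodBox (d := d) (N * L ^ (k + 1)))
      ≤ ν * energyNormW L (k + 1) Us X (periodBox (d := d) (N * L ^ (k + 1))))
    (hN1 : ε / ((L : ℝ) ^ (k + 1)) ^ 2 * (∑ p ∈ perWin d (N * L ^ (k + 1)), ‖curl Us XN p‖)
      ≤ κ₁ * energyNormW L (k + 1) Us X (periodBox (d := d) (N * L ^ (k + 1))) ^ 2)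
    (hline : 2 * κ₁ < ((((1 / 2 - ν ^ 2) / (2 * (1 + CP)) - ν ^ 2) / 2
        - 576 * d * (Real.exp α - 1) ^ 2 * ((L : ℝ) ^ (k + 1)) ^ 2) / (Fintype.card n : ℝ)
        - 28 * d * (ε / ((L : ℝ) ^ (k + 1)) ^ 2 + 7 * α ^ 2) * ((L : ℝ) ^ (k + 1)) ^ 2))
    (hU' : U' ∈ admissible (sfClass d L N ε) L (k + 1) V) {r₁ : ℝ} (hUsr : SmallField Us r₁) : SmallField U' r₁ := by
  -- the gauge identity gives the action equality and the class radius of the representative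
  have hle : levelAction d L N (k + 1) (vary Us X 1) ≤ levelAction d L N (k + 1) U' := by
    rw [← hgauge, levelAction_gaugeAct]
  have h1 : SmallField (vary Us X 1) (ε / ((L : ℝ) ^ (k + 1)) ^ 2) := by
    rw [← hgauge]
    exact smallField_gaugeAct hu hU'.1.2.2
  obtain ⟨-, hself⟩ := vary_eq_self_of_tanCritical_rep_generic hL hN hε hCP 𝒯 hT hP hmem hcritT hmin' hXs hXP hα hXα hle h1 hsplit hXT hXNs
    hNw hN1 hline
  rw [hself] at hgauge
  exact smallField_of_gaugeAct_eq hu hgauge hUsr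

/-- **ALL-SMALL ON THE CLASS OVER `𝒯`** (F26's `allSmall_of_tanCritical_repW_gauge` with `T_♮ ↦ 𝒯 k U♯`; the letter of F27's minimisation road): (hT), (hP),
`U♯ ∈ admissible (sfClass d L N ε) L (k+1) V` tangent-critical, `SmallField U♯ r₁`; every admissible `U′` represented over `U♯` WITH THE GAUGE IDENTITY `U′^u = U♯e^X`,
`X = X_T + X_N`, `X_T ∈ 𝒯 k U♯`, F9's weighted letters under the STRICT line ⟹ every admissible `U′` with `levelAction U′ ≤ levelAction U♯` is `SmallField · r₁`. [folklore] -/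
theorem allSmall_of_tanCritical_rep_generic_gauge [Nonempty n] {L N k : ℕ} [NeZero L] [NeZero N] (hL : 1 ≤ L) (hN : 1 ≤ N) {ε CP : ℝ}
    (hε : 0 ≤ ε) (hCP : 0 < CP)
    (𝒯 : ℕ → (Site d → Fin d → (Matrix n n ℂ)ˣ) → Set (Site d → Fin d → Matrix n n ℂ))
    (hT : ∀ (j : ℕ) (W : Site d → Fin d → (Matrix n n ℂ)ˣ), W ∈ sfClass d L N ε (j + 1) → ∀ F : Finset (Plaq d),
      (∀ φ : Site d → Fin d → Matrix n n ℂ, IsSkewDir φ → IsPeriodicDir φ ((tower L N (j + 1) : ℕ) : ℤ) → TangentIter L j W φ → dAction W φ F = 0) →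
      ∀ Y ∈ 𝒯 j W, dAction W Y F = 0)
    (hP : ∀ (j : ℕ) (W : Site d → Fin d → (Matrix n n ℂ)ˣ), W ∈ sfClass d L N ε (j + 1) →
      SlicePoincare L (j + 1) W (𝒯 j W) CP (periodBox (d := d) (N * L ^ (j + 1))))
    {V Us : Site d → Fin d → (Matrix n n ℂ)ˣ} (hmem : Us ∈ admissible (sfClass d L N ε) L (k + 1) V)
    (hcritT : ∀ φ : Site d → Fin d → Matrix n n ℂ, IsSkewDir φ → IsPeriodicDir φ ((N * L ^ (k + 1) : ℕ) : ℤ) → TangentIter L k Us φ →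
      dAction Us φ (perWin d (N * L ^ (k + 1))) = 0)
    (hrep : ∀ U' ∈ admissible (sfClass d L N ε) L (k + 1) V, ∃ (u : Site d → (Matrix n n ℂ)ˣ) (X XT XN : Site d → Fin d → Matrix n n ℂ)
      (α ν κ₁ : ℝ), IsUnitarySite u ∧ IsSkewDir X ∧ IsPeriodicDir X ((N * L ^ (k + 1) : ℕ) : ℤ) ∧ 0 ≤ α ∧ (∀ x μ, ‖X x μ‖ ≤ α) ∧
      gaugeAct u U' = vary Us X 1 ∧
      X = XT + XN ∧ XT ∈ 𝒯 k Us ∧ IsSkewDir XN ∧ 0 ≤ ν ∧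
      energyNormW L (k + 1) Us XN (periodBox (d := d) (N * L ^ (k + 1)))
        ≤ ν * energyNormW L (k + 1) Us X (periodBox (d := d) (N * L ^ (k + 1))) ∧
      ε / ((L : ℝ) ^ (k + 1)) ^ 2 * (∑ p ∈ perWin d (N * L ^ (k + 1)), ‖curl Us XN p‖)
        ≤ κ₁ * energyNormW L (k + 1) Us X (periodBox (d := d) (N * L ^ (k + 1))) ^ 2 ∧
      2 * κ₁ < ((((1 / 2 - ν ^ 2) / (2 * (1 + CP)) - ν ^ 2) / 2
          - 576 * d * (Real.exp α - 1) ^ 2 * ((L : ℝ) ^ (k + 1)) ^ 2) / (Fintype.card n : ℝ)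
          - 28 * d * (ε / ((L : ℝ) ^ (k + 1)) ^ 2 + 7 * α ^ 2) * ((L : ℝ) ^ (k + 1)) ^ 2))
    {r₁ : ℝ} (hUsr : SmallField Us r₁) :
    ∀ U' ∈ admissible (sfClass d L N ε) L (k + 1) V, levelAction d L N (k + 1) U' ≤ levelAction d L N (k + 1) Us → SmallField U' r₁ := by
  intro U' hU' hmin'
  obtain ⟨u, X, XT, XN, α, ν, κ₁, hu, hXs, hXP, hα, hXα, hgauge, hsplit, hXT, hXNs, -, hNw, hN1, hline⟩ := hrep U' hU'
  exact smallField_of_le_of_rep_generic_gauge hL hN hε hCP 𝒯 hT hP hmem hcritT hmin' hu hXs hXP hα hXα hgauge hsplit hXT hXNs hNw hN1 hline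
    hU' hUsr

/-- **HENCE ALSO CONV OVER `𝒯`** (F26's `isMinimiser_of_tanCritical_repW_gauge` with `T_♮ ↦ 𝒯 k U♯`): under the same REP-over-`𝒯`-with-gauge hypothesis `U♯` IS a
minimiser — §1's `isMinimiser_of_tanCritical_rep_generic`, its `hrep` read off the gauge identity (`levelAction` and the class radius are gauge invariant). [folklore] -/
theorem isMinimiser_of_tanCritical_rep_generic_gauge [Nonempty n] {L N k : ℕ} [NeZero L] [NeZero N] (hL : 1 ≤ L) (hN : 1 ≤ N) {ε CP : ℝ}
    (hε : 0 ≤ ε) (hCP : 0 < CP)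
    (𝒯 : ℕ → (Site d → Fin d → (Matrix n n ℂ)ˣ) → Set (Site d → Fin d → Matrix n n ℂ))
    (hT : ∀ (j : ℕ) (W : Site d → Fin d → (Matrix n n ℂ)ˣ), W ∈ sfClass d L N ε (j + 1) → ∀ F : Finset (Plaq d),
      (∀ φ : Site d → Fin d → Matrix n n ℂ, IsSkewDir φ → IsPeriodicDir φ ((tower L N (j + 1) : ℕ) : ℤ) → TangentIter L j W φ → dAction W φ F = 0) →
      ∀ Y ∈ 𝒯 j W, dAction W Y F = 0)
    (hP : ∀ (j : ℕ) (W : Site d → Fin d → (Matrix n n ℂ)ˣ), W ∈ sfClass d L N ε (j + 1) →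
      SlicePoincare L (j + 1) W (𝒯 j W) CP (periodBox (d := d) (N * L ^ (j + 1))))
    {V Us : Site d → Fin d → (Matrix n n ℂ)ˣ} (hmem : Us ∈ admissible (sfClass d L N ε) L (k + 1) V)
    (hcritT : ∀ φ : Site d → Fin d → Matrix n n ℂ, IsSkewDir φ → IsPeriodicDir φ ((N * L ^ (k + 1) : ℕ) : ℤ) → TangentIter L k Us φ →
      dAction Us φ (perWin d (N * L ^ (k + 1))) = 0)
    (hrep : ∀ U' ∈ admissible (sfClass d L N ε) L (k + 1) V, ∃ (u : Site d → (Matrix n n ℂ)ˣ) (X XT XN : Site d → Fin d → Matrix n n ℂ)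
      (α ν κ₁ : ℝ), IsUnitarySite u ∧ IsSkewDir X ∧ IsPeriodicDir X ((N * L ^ (k + 1) : ℕ) : ℤ) ∧ 0 ≤ α ∧ (∀ x μ, ‖X x μ‖ ≤ α) ∧
      gaugeAct u U' = vary Us X 1 ∧
      X = XT + XN ∧ XT ∈ 𝒯 k Us ∧ IsSkewDir XN ∧ 0 ≤ ν ∧
      energyNormW L (k + 1) Us XN (periodBox (d := d) (N * L ^ (k + 1)))
        ≤ ν * energyNormW L (k + 1) Us X (periodBox (d := d) (N * L ^ (k + 1))) ∧
      ε / ((L : ℝ) ^ (k + 1)) ^ 2 * (∑ p ∈ perWin d (N * L ^ (k + 1)), ‖curl Us XN p‖)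
        ≤ κ₁ * energyNormW L (k + 1) Us X (periodBox (d := d) (N * L ^ (k + 1))) ^ 2 ∧
      2 * κ₁ < ((((1 / 2 - ν ^ 2) / (2 * (1 + CP)) - ν ^ 2) / 2
          - 576 * d * (Real.exp α - 1) ^ 2 * ((L : ℝ) ^ (k + 1)) ^ 2) / (Fintype.card n : ℝ)
          - 28 * d * (ε / ((L : ℝ) ^ (k + 1)) ^ 2 + 7 * α ^ 2) * ((L : ℝ) ^ (k + 1)) ^ 2)) :
    IsMinimiser d (sfClass d L N ε) L N (k + 1) V Us := by
  refine isMinimiser_of_tanCritical_rep_generic hL hN hε hCP 𝒯 hT hP hmem hcritT fun U' hU' => ?_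
  obtain ⟨u, X, XT, XN, α, ν, κ₁, hu, hXs, hXP, hα, hXα, hgauge, hsplit, hXT, hXNs, hν, hNw, hN1, hline⟩ := hrep U' hU'
  refine ⟨X, XT, XN, α, ν, κ₁, hXs, hXP, hα, hXα, ?_, ?_, hsplit, hXT, hXNs, hν, hNw, hN1, hline.le⟩
  · rw [← hgauge, levelAction_gaugeAct]
  · rw [← hgauge]
    exact smallField_gaugeAct hu hU'.1.2.2

/-! ## §3 Instances: the corner-free slice `𝒯_E`, `d = 4`, `L = 2`, SU(2), `0 < ε ≤ 10⁻⁵³` -/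

/-- **ONE-STEP AT `d = 4`, `L = 2`, SU(2)∕U(2) (`card n = 2`), `0 < ε ≤ 10⁻⁵³`, FROM CRIT-ONE-STEP ON THE TANGENT SPACE AND REP OVER `𝒯_E = energyBlockLandauW`** (F19 §3's
`oneStep_SU2_of_tanCritical_repW` with `T_♮ ↦ 𝒯_E`): (hT) by `NE7ConvOneStepGenericSlice.hT_energyBlockLandau` (level family `levelSmall_all_d4_L2`), (hP) by
`classSlicePoincare_energyBlockLandau_SU2`, constant of record `CP = 8·CPLine 4 2 2 10⁻¹⁷ 10⁻⁵³ + 1`. [folklore] -/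
theorem oneStep_SU2_of_tanCritical_repE [Nonempty n] (hn : Fintype.card n = 2) {N : ℕ} [NeZero N] (hN : 1 ≤ N) {ε δ : ℝ} (hε : 0 < ε)
    (hε' : ε ≤ 1 / 10 ^ 53) {V : Site 4 → Fin 4 → (Matrix n n ℂ)ˣ}
    (hcrit : ∀ (k : ℕ) (U₀ : Site 4 → Fin 4 → (Matrix n n ℂ)ˣ), U₀ ∈ admissible (sfClass 4 2 N ε) 2 (k + 1) V →
      SmallField U₀ (δ / (((2 : ℕ) : ℝ) ^ k) ^ 2) →
      ∃ Us : Site 4 → Fin 4 → (Matrix n n ℂ)ˣ, Us ∈ admissible (sfClass 4 2 N ε) 2 (k + 1) V ∧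
        SmallField Us (δ / (((2 : ℕ) : ℝ) ^ (k + 1)) ^ 2) ∧
        (∀ φ : Site 4 → Fin 4 → Matrix n n ℂ, IsSkewDir φ → IsPeriodicDir φ ((N * 2 ^ (k + 1) : ℕ) : ℤ) → TangentIter 2 k Us φ →
          dAction Us φ (perWin 4 (N * 2 ^ (k + 1))) = 0) ∧
        ∀ U' ∈ admissible (sfClass 4 2 N ε) 2 (k + 1) V, ∃ (X XT XN : Site 4 → Fin 4 → Matrix n n ℂ) (α ν κ₁ : ℝ),
          IsSkewDir X ∧ IsPeriodicDir X ((N * 2 ^ (k + 1) : ℕ) : ℤ) ∧ 0 ≤ α ∧ (∀ x μ, ‖X x μ‖ ≤ α) ∧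
          levelAction 4 2 N (k + 1) (vary Us X 1) ≤ levelAction 4 2 N (k + 1) U' ∧
          SmallField (vary Us X 1) (ε / (((2 : ℕ) : ℝ) ^ (k + 1)) ^ 2) ∧
          X = XT + XN ∧ XT ∈ energyBlockLandauW (d := 4) (n := n) 2 N (k + 1) Us ∧ IsSkewDir XN ∧ 0 ≤ ν ∧
          energyNormW 2 (k + 1) Us XN (periodBox (d := 4) (N * 2 ^ (k + 1)))
            ≤ ν * energyNormW 2 (k + 1) Us X (periodBox (d := 4) (N * 2 ^ (k + 1))) ∧
          ε / (((2 : ℕ) : ℝ) ^ (k + 1)) ^ 2 * (∑ p ∈ perWin 4 (N * 2 ^ (k + 1)), ‖curl Us XN p‖)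
            ≤ κ₁ * energyNormW 2 (k + 1) Us X (periodBox (d := 4) (N * 2 ^ (k + 1))) ^ 2 ∧
          2 * κ₁ ≤ ((((1 / 2 - ν ^ 2) / (2 * (1 + (8 * CPLine 4 2 2 (1 / 10 ^ 17) (1 / 10 ^ 53) + 1))) - ν ^ 2) / 2
              - 576 * (4 : ℕ) * (Real.exp α - 1) ^ 2 * ((((2 : ℕ) : ℝ)) ^ (k + 1)) ^ 2) / (Fintype.card n : ℝ)
              - 28 * (4 : ℕ) * (ε / (((2 : ℕ) : ℝ) ^ (k + 1)) ^ 2 + 7 * α ^ 2) * ((((2 : ℕ) : ℝ)) ^ (k + 1)) ^ 2)) :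
    ∀ (k : ℕ) (U₀ : Site 4 → Fin 4 → (Matrix n n ℂ)ˣ), U₀ ∈ admissible (sfClass 4 2 N ε) 2 (k + 1) V →
      SmallField U₀ (δ / (((2 : ℕ) : ℝ) ^ k) ^ 2) →
      ∃ U, IsMinimiser 4 (sfClass 4 2 N ε) 2 N (k + 1) V U ∧ SmallField U (δ / (((2 : ℕ) : ℝ) ^ (k + 1)) ^ 2) := by
  have hls := levelSmall_all_d4_L2 hε.le (hε'.trans (by norm_num))
  have hCP : 0 < 8 * CPLine 4 2 2 (1 / 10 ^ 17) (1 / 10 ^ 53) + 1 := by linarith [CPLine_nonneg_d4_L2]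
  exact oneStep_of_tanCritical_rep_generic (d := 4) (by norm_num) hN hε.le hCP
    (fun j W => energyBlockLandauW (d := 4) (n := n) 2 N (j + 1) W)
    (fun j W hW F htan => hT_energyBlockLandau (by norm_num) hε.le hls j W hW F htan)
    (fun j W hW => slicePoincare_mono (classSlicePoincare_energyBlockLandau_SU2 hn hN hε hε' j W hW) (by linarith)) hcrit

/-- **ALL-SMALL ON THE SU(2) CLASS OVER `𝒯_E`, `d = 4`, `L = 2`, `0 < ε ≤ 10⁻⁵³`** (§2's `allSmall_of_tanCritical_rep_generic_gauge` at `𝒯_E`, (hT)∕(hP) discharged as in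
`oneStep_SU2_of_tanCritical_repE`): `U♯` admissible and tangent-critical, `SmallField U♯ r₁`, REP over `𝒯_E(U♯)` with the gauge identity under the STRICT line ⟹ every admissible
`U′` with `levelAction U′ ≤ levelAction U♯` is `SmallField · r₁`. [folklore] -/
theorem allSmall_SU2_of_tanCritical_repE_gauge [Nonempty n] (hn : Fintype.card n = 2) {N k : ℕ} [NeZero N] (hN : 1 ≤ N) {ε : ℝ} (hε : 0 < ε)
    (hε' : ε ≤ 1 / 10 ^ 53) {V Us : Site 4 → Fin 4 → (Matrix n n ℂ)ˣ} (hmem : Us ∈ admissible (sfClass 4 2 N ε) 2 (k + 1) V)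
    (hcritT : ∀ φ : Site 4 → Fin 4 → Matrix n n ℂ, IsSkewDir φ → IsPeriodicDir φ ((N * 2 ^ (k + 1) : ℕ) : ℤ) → TangentIter 2 k Us φ →
      dAction Us φ (perWin 4 (N * 2 ^ (k + 1))) = 0)
    (hrep : ∀ U' ∈ admissible (sfClass 4 2 N ε) 2 (k + 1) V, ∃ (u : Site 4 → (Matrix n n ℂ)ˣ) (X XT XN : Site 4 → Fin 4 → Matrix n n ℂ)
      (α ν κ₁ : ℝ), IsUnitarySite u ∧ IsSkewDir X ∧ IsPeriodicDir X ((N * 2 ^ (k + 1) : ℕ) : ℤ) ∧ 0 ≤ α ∧ (∀ x μ, ‖X x μ‖ ≤ α) ∧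
      gaugeAct u U' = vary Us X 1 ∧
      X = XT + XN ∧ XT ∈ energyBlockLandauW (d := 4) (n := n) 2 N (k + 1) Us ∧ IsSkewDir XN ∧ 0 ≤ ν ∧
      energyNormW 2 (k + 1) Us XN (periodBox (d := 4) (N * 2 ^ (k + 1)))
        ≤ ν * energyNormW 2 (k + 1) Us X (periodBox (d := 4) (N * 2 ^ (k + 1))) ∧
      ε / (((2 : ℕ) : ℝ) ^ (k + 1)) ^ 2 * (∑ p ∈ perWin 4 (N * 2 ^ (k + 1)), ‖curl Us XN p‖)
        ≤ κ₁ * energyNormW 2 (k + 1) Us X (periodBox (d := 4) (N * 2 ^ (k + 1))) ^ 2 ∧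
      2 * κ₁ < ((((1 / 2 - ν ^ 2) / (2 * (1 + (8 * CPLine 4 2 2 (1 / 10 ^ 17) (1 / 10 ^ 53) + 1))) - ν ^ 2) / 2
          - 576 * (4 : ℕ) * (Real.exp α - 1) ^ 2 * ((((2 : ℕ) : ℝ)) ^ (k + 1)) ^ 2) / (Fintype.card n : ℝ)
          - 28 * (4 : ℕ) * (ε / (((2 : ℕ) : ℝ) ^ (k + 1)) ^ 2 + 7 * α ^ 2) * ((((2 : ℕ) : ℝ)) ^ (k + 1)) ^ 2))
    {r₁ : ℝ} (hUsr : SmallField Us r₁) :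
    ∀ U' ∈ admissible (sfClass 4 2 N ε) 2 (k + 1) V, levelAction 4 2 N (k + 1) U' ≤ levelAction 4 2 N (k + 1) Us → SmallField U' r₁ := by
  have hls := levelSmall_all_d4_L2 hε.le (hε'.trans (by norm_num))
  have hCP : 0 < 8 * CPLine 4 2 2 (1 / 10 ^ 17) (1 / 10 ^ 53) + 1 := by linarith [CPLine_nonneg_d4_L2]
  exact allSmall_of_tanCritical_rep_generic_gauge (d := 4) (by norm_num) hN hε.le hCP
    (fun j W => energyBlockLandauW (d := 4) (n := n) 2 N (j + 1) W)
    (fun j W hW F htan => hT_energyBlockLandau (by norm_num) hε.le hls j W hW F htan)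
    (fun j W hW => slicePoincare_mono (classSlicePoincare_energyBlockLandau_SU2 hn hN hε hε' j W hW) (by linarith)) hmem hcritT hrep hUsr

end

end Summit.QuantumFields.BalabanUV.T4Continuum.NE7ConvOneStepGenericSliceTangent
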